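import Summits.Ventures.PercRepro.Night2FatDegFree
import Summits.Ventures.PercRepro.Night2FatZThreeB

import Summits.Ventures.PercRepro.Night2FatDegWitnessW1
import Summits.Ventures.PercRepro.Night2FatDegWitnessW2

/-!
# night-2: the witnesses of the singly degenerate regime — a side point and free points

For every lossy basis pair of the singly degenerate regime (the side points `M = π₃ ∖ L` collinear, the points of
`π₂` off the spine of rank `≥ 3`, the spine a class line), `W ∖ {x}` contains a side point `y₃` and either two free
points, or a second side point and one free point (**`exists_side_and_free_deg`**).  The basis points split as
`L₀ ∪ P₂ ∪ P₃` (on the spine / in `π₂` off it / side), `|L₀| ≤ 2`, `|L₀ ∪ P₂| ≤ 3`, `|P₃| ≤ 2`; the side points of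
`W ∖ {x}` number `|M| − |P₃| ≥ 1`; the free points come from `π₂` off the class basis lines through the basis
points of `π₂` (at most one class basis line through a basis point off the spine, `no_two_class_lines_through_off`)
or from the spine (`free_of_spine_point`), case by case on `|P₂| ∈ {0, 1, 2, 3}`.
Paper `proofs/NIGHT-2-g35.md` §4.
-/

namespace PercRepro.Shadow

open PercRepro.ThmH PercRepro.PerFlat

variable {α : Type*} [DecidableEq α] {M : Matroid α} [M.Finite] {G : Finset α}

/-- **A side point and free points** for every lossy basis pair of the singly degenerate regime. -/
theorem exists_side_and_free_deg (hG : G ∈ flatsQ M (5 + 1)) (hd : (gr M \ G).card = 2)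
    (hk : kColoops M G = 1) (hs : ∀ e ∈ gr M, ∀ f ∈ gr M, e ≠ f → rkN M {e, f} = 2)
    (hfat : (fatClosures M 5 G 2).card ≤ 1) {B₀ : Finset α}
    (hB₀ : B₀ ∈ thinMembers M 5 G) {w₀ x : α} (hD : G \ clF M B₀ = {w₀, x}) (hne : w₀ ≠ x) {R₁ : Finset α}
    (hR₁V : R₁ ⊆ (G \ coloops M G) \ {w₀, x}) (hR₁2 : rkN M R₁ = 2) (hR₁3 : 3 ≤ R₁.card)
    (hcop : rkN M (insert w₀ (insert x R₁)) ≤ 3) {c₂ c₃ : α}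
    (hc₂V : c₂ ∈ (G \ coloops M G) \ {w₀, x}) (hc₃V : c₃ ∈ (G \ coloops M G) \ {w₀, x})
    (hc₂ : c₂ ∉ clF M R₁) (hc₃ : c₃ ∉ clF M (insert c₂ R₁))
    (hcover : ∀ e ∈ (G \ coloops M G) \ {w₀, x}, e ∈ clF M (insert c₂ R₁) ∨ e ∈ clF M (insert c₃ R₁))
    (hnd₂ : 3 ≤ rkN M (((G \ coloops M G) \ {w₀, x}).filter
      (fun e => e ∈ clF M (insert c₂ R₁) ∧ e ∉ clF M R₁)))
    (hdeg₃ : rkN M (((G \ coloops M G) \ {w₀, x}).filter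
      (fun e => e ∈ clF M (insert c₃ R₁) ∧ e ∉ clF M R₁)) ≤ 2)
    {B : Finset α} (hB : B ∈ thinMembers M 5 G) (hnP : ¬ bigP M G B) {z : α} (hz : z ∈ G \ clF M B)
    (hw₀ : w₀ ∈ insert z B) (hx : x ∉ insert z B) :
    ∃ y₃ ∈ (G \ insert z B).erase x, (y₃ ∈ clF M (insert c₃ R₁) ∧ y₃ ∉ clF M R₁) ∧
      ((∃ f₁ ∈ (G \ insert z B).erase x, ∃ f₂ ∈ (G \ insert z B).erase x, f₁ ≠ f₂ ∧
          (f₁ ∉ clF M (((G \ coloops M G) \ {w₀, x}).filter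
            (fun e => e ∈ clF M (insert c₃ R₁) ∧ e ∉ clF M R₁)) ∧
           ∀ a ∈ (insert z B \ coloops M G).erase w₀, ∀ b ∈ (insert z B \ coloops M G).erase w₀, a ≠ b →
             f₁ ∈ clF M {a, b} → rkN M (insert w₀ (insert x {a, b})) ≤ 3 →
             4 ≤ rkN M ({a, b} ∪ ((G \ coloops M G) \ {w₀, x}).filter
               (fun e => e ∈ clF M (insert c₃ R₁) ∧ e ∉ clF M R₁))) ∧
          (f₂ ∉ clF M (((G \ coloops M G) \ {w₀, x}).filter
            (fun e => e ∈ clF M (insert c₃ R₁) ∧ e ∉ clF M R₁)) ∧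
           ∀ a ∈ (insert z B \ coloops M G).erase w₀, ∀ b ∈ (insert z B \ coloops M G).erase w₀, a ≠ b →
             f₂ ∈ clF M {a, b} → rkN M (insert w₀ (insert x {a, b})) ≤ 3 →
             4 ≤ rkN M ({a, b} ∪ ((G \ coloops M G) \ {w₀, x}).filter
               (fun e => e ∈ clF M (insert c₃ R₁) ∧ e ∉ clF M R₁)))) ∨
       (∃ y₃' ∈ (G \ insert z B).erase x, y₃' ≠ y₃ ∧ (y₃' ∈ clF M (insert c₃ R₁) ∧ y₃' ∉ clF M R₁) ∧
          ∃ f ∈ (G \ insert z B).erase x,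
            f ∉ clF M (((G \ coloops M G) \ {w₀, x}).filter
              (fun e => e ∈ clF M (insert c₃ R₁) ∧ e ∉ clF M R₁)) ∧
            ∀ a ∈ (insert z B \ coloops M G).erase w₀, ∀ b ∈ (insert z B \ coloops M G).erase w₀, a ≠ b →
              f ∈ clF M {a, b} → rkN M (insert w₀ (insert x {a, b})) ≤ 3 →
              4 ≤ rkN M ({a, b} ∪ ((G \ coloops M G) \ {w₀, x}).filter
                (fun e => e ∈ clF M (insert c₃ R₁) ∧ e ∉ clF M R₁)))) := by
  -- basic facts
  have hGg : G ⊆ gr M := (mem_flatsQ.1 hG).1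
  set V := (G \ coloops M G) \ {w₀, x} with hV
  have hVg : V ⊆ gr M := fun e he => hGg (Finset.mem_sdiff.1 (Finset.mem_sdiff.1 he).1).1
  set P := (insert z B \ coloops M G).erase w₀ with hP
  set W := (G \ insert z B).erase x with hW
  have hPV : P ⊆ V := basis_points_subset_V hB hz hx
  have hWV : W ⊆ V := W_subset_V hG hd hB hw₀
  have hPW : ∀ e ∈ P, e ∉ W := fun e he => basis_point_notMem_W he
  have hPind : M.Indep (P : Set α) := basis_points_indep hG hd hk hB hnP hz
  have hP4 : P.card = 4 := card_basis_points hG hd hk hB₀ hD hB hnP hz hw₀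
  have hw₀g : w₀ ∈ gr M := by
    have : w₀ ∈ G \ clF M B₀ := by rw [hD]; exact Finset.mem_insert_self _ _
    exact hGg (Finset.mem_sdiff.1 this).1
  have hxg : x ∈ gr M := by
    have : x ∈ G \ clF M B₀ := by rw [hD]; exact Finset.mem_insert_of_mem (Finset.mem_singleton_self _)
    exact hGg (Finset.mem_sdiff.1 this).1
  have hw₀V : w₀ ∉ clF M V := w₀_notMem_clF_V hD
  have hR₁g : R₁ ⊆ gr M := hR₁V.trans hVg
  have hc₂g : c₂ ∈ gr M := hVg hc₂V
  have hc₃g : c₃ ∈ gr M := hVg hc₃V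
  have hc₃L : c₃ ∉ clF M R₁ := fun h => hc₃ (clF_mono (Finset.subset_insert _ _) h)
  have hPorW : ∀ e ∈ V, e ∈ P ∨ e ∈ W := fun e he => mem_basis_or_W_of_mem_V he
  set Mset := V.filter (fun e => e ∈ clF M (insert c₃ R₁) ∧ e ∉ clF M R₁) with hMset
  have hMg : Mset ⊆ gr M := (Finset.filter_subset _ _).trans hVg
  have hM3 : 3 ≤ Mset.card := three_le_card_side_of_fat hG hd hk hs hfat hB₀ hD hne hR₁V hR₁2 hR₁3 hcop hc₂V hc₃V
    hc₂ hc₃ hcover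
  have hM2 : 1 < Mset.card := by omega
  have hMne : Mset.Nonempty := Finset.card_pos.1 (by omega)
  -- the basis points on the side line
  set P₃ := P.filter (fun e => e ∈ Mset) with hP₃
  have hP₃2 : P₃.card ≤ 2 := by
    have hsub : P₃ ⊆ P.filter (fun e => e ∈ clF M Mset) := by
      intro e he
      rw [hP₃, Finset.mem_filter] at he
      exact Finset.mem_filter.2 ⟨he.1, subset_clF_of_subset_gr hMg he.2⟩
    exact (Finset.card_le_card hsub).trans (card_filter_clF_le_two_of_indep hPind hdeg₃)
  -- the side points of `W`
  set M' := W.filter (fun e => e ∈ Mset) with hM'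
  have hMsplit : Mset.card = P₃.card + M'.card := by
    have hMmem : ∀ e, e ∈ Mset → e ∈ V := fun e he => by
      rw [hMset] at he
      exact (Finset.mem_filter.1 he).1
    have heq : Mset = P₃ ∪ M' := by
      ext e
      constructor
      · intro he
        rcases hPorW e (hMmem e he) with h | h
        · exact Finset.mem_union_left _ (Finset.mem_filter.2 ⟨h, he⟩)
        · exact Finset.mem_union_right _ (Finset.mem_filter.2 ⟨h, he⟩)
      · intro he
        rcases Finset.mem_union.1 he with h | h
        · exact (Finset.mem_filter.1 h).2
        · exact (Finset.mem_filter.1 h).2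
    have hdisj : Disjoint P₃ M' := by
      rw [Finset.disjoint_left]
      intro e he₁ he₂
      exact hPW e (Finset.mem_filter.1 he₁).1 (Finset.mem_filter.1 he₂).1
    rw [heq, Finset.card_union_of_disjoint hdisj]
  have hM'1 : 1 ≤ M'.card := by omega
  obtain ⟨y₃, hy₃⟩ := Finset.card_pos.1 (by omega : 0 < M'.card)
  rw [hM', Finset.mem_filter] at hy₃
  have hy₃side : y₃ ∈ clF M (insert c₃ R₁) ∧ y₃ ∉ clF M R₁ := (Finset.mem_filter.1 hy₃.2).2
  refine ⟨y₃, hy₃.1, hy₃side, ?_⟩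
  -- the basis points on the spine and in `π₂` off the spine
  set L₀ := P.filter (fun e => e ∈ clF M R₁) with hL₀
  set P₂ := P.filter (fun e => e ∈ clF M (insert c₂ R₁) ∧ e ∉ clF M R₁) with hP₂
  have hL₀2 : L₀.card ≤ 2 := by
    have := card_filter_clF_le_rkN_of_indep (X := R₁) hPind
    rw [hR₁2] at this
    exact this
  have hπ₂3 : (P.filter (fun e => e ∈ clF M (insert c₂ R₁))).card ≤ 3 := by
    have := card_filter_clF_le_rkN_of_indep (X := insert c₂ R₁) hPind
    rw [rkN_insert_of_notMem_clF hc₂g hc₂, hR₁2] at this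
    exact this
  have hL₀P₂ : L₀.card + P₂.card ≤ 3 := by
    have heq : P.filter (fun e => e ∈ clF M (insert c₂ R₁)) = L₀ ∪ P₂ := by
      ext e
      rw [Finset.mem_union, hL₀, hP₂, Finset.mem_filter, Finset.mem_filter, Finset.mem_filter]
      constructor
      · rintro ⟨he, he2⟩
        by_cases heL : e ∈ clF M R₁
        · exact Or.inl ⟨he, heL⟩
        · exact Or.inr ⟨he, he2, heL⟩
      · rintro (⟨he, heL⟩ | ⟨he, he2, -⟩)
        · exact ⟨he, clF_mono (Finset.subset_insert _ _) heL⟩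
        · exact ⟨he, he2⟩
    have hdisj : Disjoint L₀ P₂ := by
      rw [Finset.disjoint_left]
      intro e he₁ he₂
      exact (Finset.mem_filter.1 he₂).2.2 (Finset.mem_filter.1 he₁).2
    rw [heq, Finset.card_union_of_disjoint hdisj] at hπ₂3
    exact hπ₂3
  have hsplit : L₀.card + P₂.card + P₃.card = 4 := by
    have heq : P = L₀ ∪ (P₂ ∪ P₃) := by
      ext e
      rw [Finset.mem_union, Finset.mem_union, hL₀, hP₂, hP₃, Finset.mem_filter, Finset.mem_filter,
        Finset.mem_filter]
      constructor
      · intro he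
        rcases spine_or_plane_or_side hcover (hPV he) with h | h | h
        · exact Or.inl ⟨he, h⟩
        · exact Or.inr (Or.inl ⟨he, h⟩)
        · exact Or.inr (Or.inr ⟨he, Finset.mem_filter.2 ⟨hPV he, h⟩⟩)
      · rintro (h | h | h) <;> exact h.1
    have hd1 : Disjoint L₀ (P₂ ∪ P₃) := by
      rw [Finset.disjoint_left]
      intro e he₁ he₂
      rw [hL₀, Finset.mem_filter] at he₁
      rw [Finset.mem_union, hP₂, hP₃, Finset.mem_filter, Finset.mem_filter] at he₂
      rcases he₂ with h | h
      · exact h.2.2 he₁.2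
      · exact (Finset.mem_filter.1 h.2).2.2 he₁.2
    have hd2 : Disjoint P₂ P₃ := by
      rw [Finset.disjoint_left]
      intro e he₁ he₂
      rw [hP₂, Finset.mem_filter] at he₁
      rw [hP₃, Finset.mem_filter] at he₂
      exact he₁.2.2 (mem_clF_of_mem_two_planes hR₁g hc₂g hc₃g hc₂ hc₃ he₁.2.1 (Finset.mem_filter.1 he₂.2).2.1)
    rw [heq, Finset.card_union_of_disjoint hd1, Finset.card_union_of_disjoint hd2] at hP4
    omega
  -- the points of `π₂` off the spine
  set Aset := V.filter (fun e => e ∈ clF M (insert c₂ R₁) ∧ e ∉ clF M R₁) with hAset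
  have hAg : Aset ⊆ gr M := (Finset.filter_subset _ _).trans hVg
  have hAW : ∀ e ∈ Aset, e ∉ P₂ → e ∈ W := by
    intro e he heP
    rcases hPorW e (Finset.mem_filter.1 he).1 with h | h
    · exact absurd (Finset.mem_filter.2 ⟨h, (Finset.mem_filter.1 he).2⟩) heP
    · exact h
  -- the spine points
  set Lset := V.filter (fun e => e ∈ clF M R₁) with hLset
  have hL3 : 3 ≤ Lset.card := by
    have hsub : R₁ ⊆ Lset := fun e he => Finset.mem_filter.2 ⟨hR₁V he, subset_clF_of_subset_gr hR₁g he⟩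
    exact hR₁3.trans (Finset.card_le_card hsub)
  have hLW : ∀ e ∈ Lset, e ∉ L₀ → e ∈ W := by
    intro e he heP
    rcases hPorW e (Finset.mem_filter.1 he).1 with h | h
    · exact absurd (Finset.mem_filter.2 ⟨h, (Finset.mem_filter.1 he).2⟩) heP
    · exact h
  -- the spine points of `W` off `clF M`: at most one spine point lies in `clF M`
  have hLM : ∀ s ∈ Lset, ∀ s' ∈ Lset, s ≠ s' → s ∈ clF M Mset → s' ∉ clF M Mset := by
    intro s hs₁ s' hs' hss' hsM hs'M
    exact hss' (eq_of_mem_spine_of_mem_clF_side hs hVg hR₁g hR₁2 hdeg₃ hMne (hVg (Finset.mem_filter.1 hs₁).1)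
      (hVg (Finset.mem_filter.1 hs').1) (Finset.mem_filter.1 hs₁).2 (Finset.mem_filter.1 hs').2 hsM hs'M)
  -- a point of `π₂` off the spine is off `clF M`
  have hAM : ∀ e ∈ Aset, e ∉ clF M Mset := fun e he =>
    notMem_clF_side_of_plane_two hR₁g hc₂g hc₃g hc₂ hc₃ (Finset.mem_filter.1 he).2.1 (Finset.mem_filter.1 he).2.2
  -- at most one class basis line through a basis point off the spine
  have hpencil : ∀ c ∈ P₂, ∀ a ∈ P, ∀ b ∈ P, c ≠ a → c ≠ b → a ≠ b →
      rkN M (insert w₀ (insert x {c, a})) ≤ 3 → rkN M (insert w₀ (insert x {c, b})) ≤ 3 → False := by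
    intro c hc a ha b hb hca hcb hab h1 h2
    exact no_two_class_lines_through_off hs hVg hw₀g hxg hne hw₀V hR₁V hR₁2 hcop hPV hPind
      (Finset.mem_filter.1 hc).1 ha hb hca hcb hab (Finset.mem_filter.1 hc).2.2 h1 h2
  -- a spine–off basis pair coplanar with `M` has its spine point in `clF M`
  have hspineM : ∀ a ∈ L₀, ∀ c ∈ P₂, rkN M ({a, c} ∪ Mset) ≤ 3 → a ∈ clF M Mset := by
    intro a ha c hc hcopl
    have hc3 : c ∉ clF M (insert c₃ R₁) := by
      intro h
      exact (Finset.mem_filter.1 hc).2.2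
        (mem_clF_of_mem_two_planes hR₁g hc₂g hc₃g hc₂ hc₃ (Finset.mem_filter.1 hc).2.1 h)
    exact mem_clF_side_of_coplanar_of_spine_of_off hs hVg hR₁g hR₁2 hc₃g hc₃L hdeg₃ hM2
      (hVg (hPV (Finset.mem_filter.1 ha).1)) (Finset.mem_filter.1 ha).2 (hVg (hPV (Finset.mem_filter.1 hc).1)) hc3 hcopl
  -- two side points when `|P₃| ≤ 1`
  have htwo : P₃.card ≤ 1 → ∃ y₃' ∈ W, y₃' ≠ y₃ ∧ (y₃' ∈ clF M (insert c₃ R₁) ∧ y₃' ∉ clF M R₁) := by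
    intro h1
    have : 1 < M'.card := by omega
    obtain ⟨y', hy', hyy'⟩ := Finset.exists_mem_ne this y₃
    rw [hM', Finset.mem_filter] at hy'
    exact ⟨y', hy'.1, hyy', (Finset.mem_filter.1 hy'.2).2⟩
  -- FREE predicate helpers: a free spine point off any class basis line of `π₂ ∖ L`
  have hfreeL : L₀.card ≤ 1 → ∀ s ∈ W, s ∈ clF M R₁ → s ∉ clF M Mset →
      (∀ c ∈ P₂, ∀ c' ∈ P₂, c ≠ c' → s ∈ clF M {c, c'} → rkN M (insert w₀ (insert x {c, c'})) ≤ 3 →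
        4 ≤ rkN M ({c, c'} ∪ Mset)) →
      s ∉ clF M Mset ∧ ∀ a ∈ P, ∀ b ∈ P, a ≠ b → s ∈ clF M {a, b} → rkN M (insert w₀ (insert x {a, b})) ≤ 3 →
        4 ≤ rkN M ({a, b} ∪ Mset) := by
    intro hL1 s hsW hsL hsM hcc
    refine ⟨hsM, ?_⟩
    apply free_of_spine_point hs hVg hR₁V hR₁2 hc₂V hc₃V hc₂ hc₃ hcover hPV hWV hPW
      (w₀ := w₀) (x := x) ?_ hsW hsL hsM
    · intro c hc c' hc' hcc' hc2 hcL hc'2 hc'L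
      exact hcc c (Finset.mem_filter.2 ⟨hc, hc2, hcL⟩) c' (Finset.mem_filter.2 ⟨hc', hc'2, hc'L⟩) hcc'
    · intro a ha b hb hab haL hbL
      have : ({a, b} : Finset α) ⊆ L₀ := by
        intro e he
        rw [Finset.mem_insert, Finset.mem_singleton] at he
        rcases he with rfl | rfl
        · exact Finset.mem_filter.2 ⟨ha, haL⟩
        · exact Finset.mem_filter.2 ⟨hb, hbL⟩
      have := Finset.card_le_card this
      rw [Finset.card_pair hab] at this
      omega
  -- a free point of `π₂` off the spine
  have hfreeA : ∀ f ∈ Aset, f ∈ W →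
      (∀ a ∈ L₀, ∀ c ∈ P₂, a ≠ c → f ∈ clF M {a, c} → rkN M (insert w₀ (insert x {a, c})) ≤ 3 →
        4 ≤ rkN M ({a, c} ∪ Mset)) →
      (∀ c ∈ P₂, ∀ c' ∈ P₂, c ≠ c' → f ∈ clF M {c, c'} → rkN M (insert w₀ (insert x {c, c'})) ≤ 3 →
        4 ≤ rkN M ({c, c'} ∪ Mset)) →
      f ∉ clF M Mset ∧ ∀ a ∈ P, ∀ b ∈ P, a ≠ b → f ∈ clF M {a, b} → rkN M (insert w₀ (insert x {a, b})) ≤ 3 →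
        4 ≤ rkN M ({a, b} ∪ Mset) := by
    intro f hf hfW hac hcc
    apply free_of_plane_point hs hVg hR₁V hR₁2 hc₂V hc₃V hc₂ hc₃ hcover hPV hWV hPW (w₀ := w₀) (x := x) hfW
      (Finset.mem_filter.1 hf).2.1 (Finset.mem_filter.1 hf).2.2
    · intro a ha c hc hac' haL hc2 hcL
      exact hac a (Finset.mem_filter.2 ⟨ha, haL⟩) c (Finset.mem_filter.2 ⟨hc, hc2, hcL⟩) hac'
    · intro c hc c' hc' hcc' hc2 hcL hc'2 hc'L
      exact hcc c (Finset.mem_filter.2 ⟨hc, hc2, hcL⟩) c' (Finset.mem_filter.2 ⟨hc', hc'2, hc'L⟩) hcc'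
  -- `Aset` has rank `≥ 3`: a point off any line
  have hAoff : ∀ X : Finset α, rkN M X ≤ 2 → ∃ f ∈ Aset, f ∉ clF M X := fun X hX =>
    exists_mem_notMem_clF_of_three_le_rkN hnd₂ hX
  have hA3 : 3 ≤ Aset.card := hnd₂.trans (rkN_le_card _)
  -- THE CASES on `|P₂|`
  rcases Nat.lt_or_ge P₂.card 1 with hP₂0 | hP₂1
  · -- `P₂ = ∅`: every point of `π₂` off the spine is a free point of `W`
    exact deg_wit_large_case_p2_empty hd hk hfat hR₁2 hR₁3 hcop hnd₂ hdeg₃ hV hP hW hMset hP₃ hM' hL₀ hP₂ hAset hLset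
          hP4 hM3 hM2 hP₃2 hMsplit hM'1 hL₀2 hπ₂3 hL₀P₂ hsplit hAW hL3 hfreeA hA3 hP₂0
  rcases Nat.lt_or_ge P₂.card 2 with hP₂1' | hP₂2
  · -- `P₂ = {c}`
    exact deg_wit_large_case_p2_one hd hk hs hfat hR₁2 hR₁3 hcop hnd₂ hdeg₃ hV hP hW hMset hP₃ hM' hL₀ hP₂ hAset hLset
          hVg hPV hP4 hM3 hM2 hP₃2 hMsplit hM'1 hL₀2 hπ₂3 hL₀P₂ hsplit hAW hL3 hLW hLM hspineM htwo hfreeL hfreeA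
          hAoff hA3 hP₂1 hP₂1'
  · -- `|P₂| ≥ 2`: then `|L₀| ≤ 1`
    exact deg_wit_large_case_p2_two hd hk hs hfat hR₁2 hR₁3 hcop hnd₂ hdeg₃ hV hP hW hMset hP₃ hM' hL₀ hP₂ hAset hLset
          hVg hPV hP4 hR₁g hM3 hM2 hP₃2 hMsplit hM'1 hL₀2 hπ₂3 hL₀P₂ hsplit hAW hL3 hLW hLM hpencil hspineM htwo
          hfreeL hfreeA hAoff hA3 hP₂2
end PercRepro.Shadow
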